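import Mathlib
import HarnessLib
import Summits.Ventures.LatticeQCDFlow.Scoring.MarkovChainCLTBatchMeans
import Summits.Ventures.LatticeQCDFlow.Scoring.DoeblinPowerBatchMeans
import Summits.Ventures.LatticeQCDFlow.Exactness.NCMCGeneralSpaceDoeblinPowerCLT

/-!
# THE STUDENTISED MARKOV-CHAIN CLT WITH THE BATCH-MEANS ERROR BAR UNDER A DOEBLIN POWER:
# `√N (f̄_N − π f) / σ̂_BM ⇒ N(0, 1)` from any initial law, for every kernel with
# `(nHit κ m)(x, ·) ≥ ε ν`, and its asymptotically exact coverage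

HONEST FRAMING: exact (Metropolis-corrected) sampling algorithms for lattice gauge theory;
figures of merit are autocorrelation/cost numbers at stated couplings and volumes; no
continuum-physics claim.

Venture `LatticeQCDFlow` (cell pub-lqcd), topic `Scoring`; FANOUT row 8 (`s0-cpn-nemc`, GEN-20).
NEW WORK of the cell, not a published result; no definition is introduced; nothing is cited as a
fact.  GEN-19's `Scoring/MarkovChainCLTBatchMeans.lean` proved the coin-free studentised CLT
`(√N_n)⁻¹ Σ_{t<N_n} (f(X_t) − πf) / σ̂_n ⇒ N(0, 1)` (`σ̂²_n = a_n b_n · SE²_BM` the batch-means estimator,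
`N_n = a_n b_n`, `a_n, b_n → ∞`) and the asymptotically exact coverage of `f̄_N ± z σ̂_BM/√N` for
kernels minorised in ONE step.  This file is the same theorem for the certificate shape of the cell's
composite samplers, a DOEBLIN POWER `ε ν ≤ (nHit κ m)(z, ·)` for all `z` (`0 < ε ≤ 1`, `0 < m`,
measure form): the ingredients are row 13's Markov-chain CLT under a Doeblin power from any initial
law (`Exactness.GeneralNCMC.tendstoInDistribution_timeAverage_of_nHit`, Poisson–martingale route, no
split chain) and the consistency of `σ̂²_n` under a Doeblin power
(`Scoring/DoeblinPowerBatchMeans.chain_batchMeans_sigmaHat_tendstoInMeasure_of_nHit`); Slutsky and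
the portmanteau step are GEN-19's verbatim.  `σ²_f > 0` is ASSUMED.  Printed counterparts NAMED ONLY:
batch-means confidence intervals for MCMC output (Glynn–Whitt 1991; Jones–Haran–Caffo–Neath 2006;
Flegal–Jones 2010).

## Content

* **`doeblinPower_batchMeans_studentized_clt`** — for `Y ~ N(0,1)`:
  `TendstoInDistribution (fun n x => ((√(b_n a_n))⁻¹ Σ_{t<b_n a_n} (f x_t − πf)) / √(σ̂²_n x)) atTop Y P_{μ₀}`;
* **`doeblinPower_batchMeans_studentized_coverage`** — `z > 0`:
  `P_{μ₀} {|(√(b_n a_n))⁻¹ Σ_{t<b_n a_n} (f x_t − πf)| / √(σ̂²_n x) ≤ z} → (gaussianReal 0 1)[−z, z]`.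

NOT CLAIMED: a rate; the degenerate case `σ²_f = 0`; an optimal choice of `(a_n, b_n)`; unbounded
`f`; any `ε, m` of a concrete sampler.
-/

noncomputable section

namespace Summit.Ventures.LatticeQCDFlow.Scoring

open MeasureTheory ProbabilityTheory Filter Finset Preorder Literature.Probability.MarkovChains
open scoped ENNReal Topology

section StudentizedBatchMeans

variable {Ω : Type*} [MeasurableSpace Ω]
  {κ : Kernel Ω Ω} [IsMarkovKernel κ] {ν : Measure Ω} [IsProbabilityMeasure ν] {ε : ℝ≥0∞} {m : ℕ}

/-- **THE STUDENTISED MARKOV-CHAIN CLT WITH THE BATCH-MEANS ERROR BAR, FROM ANY INITIAL LAW.**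
`σ²_f > 0`, `a_n → ∞`, `b_n → ∞`, `N_n = b_n a_n`; for `Y ~ N(0, 1)`:
`((√N_n)⁻¹ Σ_{t<N_n} (f(x_t) − π f)) / √(σ̂²_n) ⇒ Y` under `P_{μ₀}`, where `σ̂²_n = a_n b_n · SE²_BM` is the
batch-means estimator computed from `f(x_0), …, f(x_{N_n − 1})` alone. -/
theorem doeblinPower_batchMeans_studentized_clt {π : Measure Ω} [IsProbabilityMeasure π]
    (hπ : Kernel.Invariant κ π) (hmin : ∀ z, ε • ν ≤ Exactness.nHit κ m z)
    (hε0 : 0 < ε) (hε1 : ε ≤ 1) (hm : 0 < m)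
    {f : Ω → ℝ} (hf : Measurable f) {C : ℝ} (hC : ∀ x, |f x| ≤ C)
    (hσ : 0 < ((∫ y, (f y - ∫ z, f z ∂π) ^ 2 ∂π)
      + 2 * ∑' k, ∫ y, (f y - ∫ z, f z ∂π) * (kop κ)^[k + 1] (fun y => f y - ∫ z, f z ∂π) y ∂π))
    (μ₀ : Measure Ω) [IsProbabilityMeasure μ₀] {a b : ℕ → ℕ} (ha : Tendsto a atTop atTop)
    (hb : Tendsto b atTop atTop)
    {Ω' : Type*} [MeasurableSpace Ω'] {P' : Measure Ω'} [IsProbabilityMeasure P'] {Y : Ω' → ℝ}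
    (hY : HasLaw Y (gaussianReal 0 1) P')
    [IsProbabilityMeasure (Kernel.trajMeasure (X := fun _ : ℕ => Ω) μ₀
        (fun n : ℕ => κ.comap (fun h : (i : ↥(Finset.Iic n)) → Ω => h ⟨n, Finset.mem_Iic.2 le_rfl⟩)
          (measurable_pi_apply _)))] :
    TendstoInDistribution (fun (n : ℕ) (x : ℕ → Ω) =>
        ((Real.sqrt ((b n * a n : ℕ) : ℝ))⁻¹
          * ∑ t ∈ Finset.range (b n * a n), (f (x t) - ∫ z, f z ∂π))
        / Real.sqrt (((b n * a n : ℕ) : ℝ)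
          * replicaSEsq (fun j (x : ℕ → Ω) => (∑ i ∈ Finset.range (b n), f (x (b n * j + i))) / (b n))
            (a n) x))
      atTop Y (fun _ => (Kernel.trajMeasure (X := fun _ : ℕ => Ω) μ₀
        (fun n : ℕ => κ.comap (fun h : (i : ↥(Finset.Iic n)) → Ω => h ⟨n, Finset.mem_Iic.2 le_rfl⟩)
          (measurable_pi_apply _)))) P' := by
  set P := (Kernel.trajMeasure (X := fun _ : ℕ => Ω) μ₀
        (fun n : ℕ => κ.comap (fun h : (i : ↥(Finset.Iic n)) → Ω => h ⟨n, Finset.mem_Iic.2 le_rfl⟩)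
          (measurable_pi_apply _))) with hP
  set c := ∫ z, f z ∂π with hc
  set σ2 := ((∫ y, (f y - ∫ z, f z ∂π) ^ 2 ∂π)
      + 2 * ∑' k, ∫ y, (f y - ∫ z, f z ∂π) * (kop κ)^[k + 1] (fun y => f y - ∫ z, f z ∂π) y ∂π) with hσ2
  have hsv : Real.sqrt σ2 ≠ 0 := (Real.sqrt_pos.2 hσ).ne'
  obtain ⟨hg, -, -⟩ := centred_observable_bounds π hf hC
  -- the statistics
  set N : ℕ → ℕ := fun n => b n * a n with hN
  have hN_tend : Tendsto N atTop atTop := hb.atTop_mul_atTop₀ ha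
  have hAm : ∀ n : ℕ, Measurable fun x : ℕ → Ω =>
      (Real.sqrt ((N n : ℕ) : ℝ))⁻¹ * ∑ t ∈ Finset.range (N n), (f (x t) - c) := fun n =>
    measurable_const.mul (Finset.measurable_sum _ fun t _ => hg.comp (measurable_pi_apply t))
  have hSigm : ∀ n : ℕ, Measurable fun x : ℕ → Ω => ((b n * a n : ℕ) : ℝ)
      * replicaSEsq (fun j (x : ℕ → Ω) => (∑ i ∈ Finset.range (b n), f (x (b n * j + i))) / (b n))
        (a n) x := fun n => measurable_batchMeans_sigmaHat hf (a n) (b n)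
  have hTm : ∀ n : ℕ, Measurable fun x : ℕ → Ω =>
      ((Real.sqrt ((N n : ℕ) : ℝ))⁻¹ * ∑ t ∈ Finset.range (N n), (f (x t) - c))
        / Real.sqrt (((b n * a n : ℕ) : ℝ)
          * replicaSEsq (fun j (x : ℕ → Ω) => (∑ i ∈ Finset.range (b n), f (x (b n * j + i))) / (b n))
            (a n) x) := fun n =>
    (hAm n).div (Real.continuous_sqrt.measurable.comp (hSigm n))
  -- (1) the time-average CLT along `N n`, with limit `√σ² · Y ~ N(0, σ²)`
  have hY₁ : HasLaw (fun ω => Real.sqrt σ2 * Y ω) (gaussianReal 0 σ2.toNNReal) P' := by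
    refine ⟨hY.aemeasurable.const_mul _, ?_⟩
    rw [show (fun ω => Real.sqrt σ2 * Y ω) = (fun a : ℝ => Real.sqrt σ2 * a) ∘ Y from rfl,
      ← AEMeasurable.map_map_of_aemeasurable (measurable_const_mul _).aemeasurable hY.aemeasurable,
      hY.map_eq, gaussianReal_map_const_mul, mul_zero, mul_one]
    congr 1
    apply NNReal.coe_injective
    rw [NNReal.coe_mk, Real.coe_toNNReal _ hσ.le, Real.sq_sqrt hσ.le]
  have hclt := Exactness.GeneralNCMC.tendstoInDistribution_timeAverage_of_nHit hπ hε0.ne' hmin hm hf hC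
    μ₀ hY₁
  have hcltN : TendstoInDistribution (fun (n : ℕ) (x : ℕ → Ω) =>
      (Real.sqrt ((N n : ℕ) : ℝ))⁻¹ * ∑ t ∈ Finset.range (N n), (f (x t) - c))
      atTop (fun ω => Real.sqrt σ2 * Y ω) (fun _ => P) P' :=
    ⟨fun n => hclt.forall_aemeasurable (N n), hclt.aemeasurable_limit, hclt.tendsto.comp hN_tend⟩
  -- (2) `σ̂²_n → σ²` in probability
  have hV := chain_batchMeans_sigmaHat_tendstoInMeasure_of_nHit hπ
    (Exactness.GeneralNCMC.minorised_setwise hmin) hε0 hε1 hm hf hC μ₀ ha hb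
  rw [← hP] at hV
  -- (3) Slutsky with the continuous map `(u, w) ↦ u / √(max(w, σ²/4))`
  have hgc : Continuous fun p : ℝ × ℝ => p.1 / Real.sqrt (max p.2 (σ2 / 4)) := by
    refine continuous_fst.div ((continuous_snd.max continuous_const).sqrt) fun p => ?_
    exact (Real.sqrt_pos.2 (lt_max_of_lt_right (by positivity))).ne'
  have hS := hcltN.continuous_comp_prodMk_of_tendstoInMeasure_const hgc hV (fun n => (hSigm n).aemeasurable)
  have hS' := hS.congr (fun n => EventuallyEq.rfl) (ae_of_all _ fun ω => (by
    show Real.sqrt σ2 * Y ω / Real.sqrt (max σ2 (σ2 / 4)) = Y ω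
    rw [max_eq_left (by linarith), mul_div_cancel_left₀ _ hsv]))
  -- (4) the studentised statistic differs from the Slutsky statistic only where `σ̂²_n < σ²/4`
  refine tendstoInDistribution_of_tendstoInMeasure_sub _ Y hS' ?_ (fun n => (hTm n).aemeasurable)
  rw [tendstoInMeasure_iff_measureReal_norm]
  intro δ hδ
  have hV' := (tendstoInMeasure_iff_measureReal_norm.1 hV) (3 * σ2 / 4) (by positivity)
  refine squeeze_zero' (Eventually.of_forall fun n => measureReal_nonneg)
    (Eventually.of_forall fun n => ?_) hV'
  refine measureReal_mono fun x hx => ?_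
  simp only [Set.mem_setOf_eq, Pi.sub_apply, Pi.zero_apply, sub_zero] at hx
  rw [Set.mem_setOf_eq]
  by_contra hcon
  rw [not_le, Real.norm_eq_abs, abs_lt] at hcon
  have hmax : max (((b n * a n : ℕ) : ℝ)
      * replicaSEsq (fun j (x : ℕ → Ω) => (∑ i ∈ Finset.range (b n), f (x (b n * j + i))) / (b n))
        (a n) x) (σ2 / 4)
      = ((b n * a n : ℕ) : ℝ)
        * replicaSEsq (fun j (x : ℕ → Ω) => (∑ i ∈ Finset.range (b n), f (x (b n * j + i))) / (b n))
          (a n) x := max_eq_left (by linarith [hcon.1])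
  rw [hmax, sub_self, norm_zero] at hx
  exact absurd hx (not_le.2 hδ)

/-- **ASYMPTOTICALLY EXACT COVERAGE OF THE BATCH-MEANS INTERVAL.**  Under the hypotheses of
`doeblinPower_batchMeans_studentized_clt`, for every `z > 0`:
`P_{μ₀}(|(√N_n)⁻¹ Σ_{t<N_n} (f(x_t) − πf)| / √(σ̂²_n) ≤ z) → (gaussianReal 0 1)[−z, z]` — the interval
`f̄_{N_n} ± z σ̂_n/√N_n`, computed from the observed values alone, covers `π f` with probability
tending to the nominal Gaussian value. -/
theorem doeblinPower_batchMeans_studentized_coverage {π : Measure Ω} [IsProbabilityMeasure π]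
    (hπ : Kernel.Invariant κ π) (hmin : ∀ z, ε • ν ≤ Exactness.nHit κ m z)
    (hε0 : 0 < ε) (hε1 : ε ≤ 1) (hm : 0 < m)
    {f : Ω → ℝ} (hf : Measurable f) {C : ℝ} (hC : ∀ x, |f x| ≤ C)
    (hσ : 0 < ((∫ y, (f y - ∫ z, f z ∂π) ^ 2 ∂π)
      + 2 * ∑' k, ∫ y, (f y - ∫ z, f z ∂π) * (kop κ)^[k + 1] (fun y => f y - ∫ z, f z ∂π) y ∂π))
    (μ₀ : Measure Ω) [IsProbabilityMeasure μ₀] {a b : ℕ → ℕ} (ha : Tendsto a atTop atTop)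
    (hb : Tendsto b atTop atTop) {z : ℝ} (hz : 0 < z) :
    Tendsto (fun n : ℕ => (Kernel.trajMeasure (X := fun _ : ℕ => Ω) μ₀
        (fun n : ℕ => κ.comap (fun h : (i : ↥(Finset.Iic n)) → Ω => h ⟨n, Finset.mem_Iic.2 le_rfl⟩)
          (measurable_pi_apply _))).real
      {x | |((Real.sqrt ((b n * a n : ℕ) : ℝ))⁻¹
          * ∑ t ∈ Finset.range (b n * a n), (f (x t) - ∫ z, f z ∂π))
        / Real.sqrt (((b n * a n : ℕ) : ℝ)
          * replicaSEsq (fun j (x : ℕ → Ω) => (∑ i ∈ Finset.range (b n), f (x (b n * j + i))) / (b n))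
            (a n) x)| ≤ z})
      atTop (𝓝 ((gaussianReal 0 1).real (Set.Icc (-z) z))) := by
  haveI hPI : IsProbabilityMeasure (Kernel.trajMeasure (X := fun _ : ℕ => Ω) μ₀
        (fun n : ℕ => κ.comap (fun h : (i : ↥(Finset.Iic n)) → Ω => h ⟨n, Finset.mem_Iic.2 le_rfl⟩)
          (measurable_pi_apply _))) := inferInstance
  have hY : HasLaw (fun a : ℝ => a) (gaussianReal 0 1) (gaussianReal 0 1) :=
    ⟨aemeasurable_id', Measure.map_id'⟩
  have hclt := doeblinPower_batchMeans_studentized_clt (κ := κ) (ν := ν) hπ hmin hε0 hε1 hm hf hC hσ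
    μ₀ ha hb hY
  have hE : ((gaussianReal 0 1).map (fun a : ℝ => a)) (frontier (Set.Icc (-z) z)) = 0 := by
    rw [Measure.map_id', frontier_Icc (by linarith)]
    haveI := nullSingletonClass_gaussianReal (μ := 0) one_ne_zero
    exact (Set.toFinite _).measure_zero _
  have key := ProbabilityMeasure.tendsto_measure_of_null_frontier_of_tendsto' hclt.tendsto hE
  have hset : ∀ n : ℕ, ((Kernel.trajMeasure (X := fun _ : ℕ => Ω) μ₀
        (fun n : ℕ => κ.comap (fun h : (i : ↥(Finset.Iic n)) → Ω => h ⟨n, Finset.mem_Iic.2 le_rfl⟩)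
          (measurable_pi_apply _))).map
        (fun x : ℕ → Ω => ((Real.sqrt ((b n * a n : ℕ) : ℝ))⁻¹
          * ∑ t ∈ Finset.range (b n * a n), (f (x t) - ∫ z, f z ∂π))
        / Real.sqrt (((b n * a n : ℕ) : ℝ)
          * replicaSEsq (fun j (x : ℕ → Ω) => (∑ i ∈ Finset.range (b n), f (x (b n * j + i))) / (b n))
            (a n) x))) (Set.Icc (-z) z)
      = (Kernel.trajMeasure (X := fun _ : ℕ => Ω) μ₀
        (fun n : ℕ => κ.comap (fun h : (i : ↥(Finset.Iic n)) → Ω => h ⟨n, Finset.mem_Iic.2 le_rfl⟩)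
          (measurable_pi_apply _)))
        {x | |((Real.sqrt ((b n * a n : ℕ) : ℝ))⁻¹
          * ∑ t ∈ Finset.range (b n * a n), (f (x t) - ∫ z, f z ∂π))
        / Real.sqrt (((b n * a n : ℕ) : ℝ)
          * replicaSEsq (fun j (x : ℕ → Ω) => (∑ i ∈ Finset.range (b n), f (x (b n * j + i))) / (b n))
            (a n) x)| ≤ z} := by
    intro n
    rw [Measure.map_apply_of_aemeasurable (hclt.forall_aemeasurable n) measurableSet_Icc]
    congr 1
    ext x
    simp only [Set.mem_preimage, Set.mem_Icc, Set.mem_setOf_eq, abs_le]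
  have key' := (ENNReal.tendsto_toReal (measure_ne_top _ (Set.Icc (-z) z))).comp key
  simp only [ProbabilityMeasure.coe_mk, Function.comp_def, hset, Measure.map_id'] at key'
  simp only [measureReal_def]
  exact key'

end StudentizedBatchMeans

end Summit.Ventures.LatticeQCDFlow.Scoring

end
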